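import Literature.Probability.RandomPlanarGeometry.SAWPulledLargeForceExpansionZdFourthOrder
import HarnessLib

/-!
# The pulled self-avoiding walk on `ℤ^{d+1}` at large force: fifth-order algebra and the cost-five irreducible bridges of length six
# (`N_{5,6} = 2d(2d−1)⁴ − 2d(2d−2)(4d−3)`, the number of five-step self-avoiding walks of `ℤ^d`)

Topic `Literature/Probability/RandomPlanarGeometry` (continues `SAWPulledLargeForceExpansionZdFourthOrder.lean`: the convolution identity
`Σ_{i+j=k} a_i e_j = 0`, `a_succ`, `coeff_pow_three`, `coeff_Pz_comp_three`, `a_one … a_four`, the four-vector lemma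
`eq_revIdx_of_sum_four_eq_zero`, the index sets `nonrevFour`, `squareFour`, `fiveStepIndex`).

Printed sources: E. J. Janse van Rensburg, S. G. Whittington, J. Phys. A 46 (2013) 435003, §3.2 Theorem 8 (first order only);
N. Madras, G. Slade, *The Self-Avoiding Walk* (1993), §1.2 (the counts `c_n`), §4.2. The cost-five census is not in print (lane «pcv-sawmu»).

## Contents (all PROVED, standard axioms only; no data, no certificates)

* generic (`namespace CostSeries`): `pQ c = Σ_n C(n,4) N_{c,n}`, `coeff_pow_four`, `coeff_Pz_comp_four`, ★ `a_five`, ★ `e_five_eq`.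
* five transverse unit steps never sum to zero (`twoStepV_sum_five_ne_zero`, parity).
* the cost-five irreducible bridges of length six are exactly the walks `+e₀, v₁, …, v₅` with `(v₁, …, v₅)` a five-step self-avoiding walk of
  the transverse lattice: no immediate reversal and no unit square among steps `1–4` or `2–5` (`sixStepIndex = nonrevFive ∖ (squareA ∪ squareB)`,
  `card_nonrevFive = 2d(2d−1)⁴`, `card_squareA = card_squareB = 2d(2d−1)(2d−2)`, `card_squareA_inter_squareB = 2d(2d−2)`);
  `sixStep`, `sixStep_mem_saws`, `sixStep_mem_filter`, ★ `eq_sixStep_of_mem`, `sixStep_injective`, ★ `costCoeffZd_five_six_add`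
  (`N_{5,6} + 2d(2d−2)(4d−3) = 2d(2d−1)⁴`, subtraction-free) and ★ `costCoeffZd_five_six`.

Provenance: lane «pcv-sawmu», a-p3 g16 (2026-08-24).
-/

noncomputable section

open Finset Filter Topology
open scoped BigOperators
open Literature.Probability.LatticeModels
open Literature.Probability.RandomPlanarGeometry.SAW

namespace Literature.Probability.RandomPlanarGeometry.SAW.Zd

namespace CostSeries

variable (N : ℕ → ℕ → ℕ)

/-! ### Generic: fourth coefficients of powers and compositions, `a_5`, `e_5` -/

/-- `pQ c = P_c''''(1)/24 = Σ_n C(n,4) N_{c,n}`. [cite: JansevanRensburgWhittington2013, §3.2 Theorem 8 (arXiv v4 p. 11)] -/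
def pQ (c : ℕ) : ℤ := ∑ n ∈ Finset.range (2 * c + 2), (n.choose 4 : ℤ) * N c n

/-- The coefficient `4` of `p^n` when `p(0) = 1`: `n p₄ + C(n,2)(2 p₁ p₃ + p₂²) + 3 C(n,3) p₁² p₂ + C(n,4) p₁⁴`.
[cite: JansevanRensburgWhittington2013, §3.2 Theorem 8 (arXiv v4 p. 11)] -/
theorem coeff_pow_four (p : Polynomial ℤ) (h0 : p.coeff 0 = 1) (n : ℕ) :
    (p ^ n).coeff 4 = n * p.coeff 4 + (n.choose 2 : ℤ) * (2 * (p.coeff 1 * p.coeff 3) + p.coeff 2 ^ 2) +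
      3 * (n.choose 3 : ℤ) * (p.coeff 1 ^ 2 * p.coeff 2) + (n.choose 4 : ℤ) * p.coeff 1 ^ 4 := by
  induction n with
  | zero => simp [Polynomial.coeff_one]
  | succ n ih =>
    obtain ⟨i0, i1, i2⟩ := coeff_pow_low p h0 n
    have i3 := coeff_pow_three p h0 n
    rw [pow_succ, Polynomial.coeff_mul, Finset.Nat.sum_antidiagonal_eq_sum_range_succ_mk]
    simp only [Finset.sum_range_succ, Finset.sum_range_zero, Nat.reduceSub, Nat.sub_self, zero_add]
    rw [i0, i1, i2, i3, ih, h0, Nat.choose_succ_succ n 1, Nat.choose_succ_succ n 2, Nat.choose_succ_succ n 3, Nat.choose_one_right]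
    push_cast; ring

/-- `[X⁴](P_c ∘ q) = pD q₄ + pH (2 q₁ q₃ + q₂²) + 3 pT q₁² q₂ + pQ q₁⁴` for `q(0) = 1`. [cite: JansevanRensburgWhittington2013, §3.2 Theorem 8 (arXiv v4 p. 11)] -/
theorem coeff_Pz_comp_four (c : ℕ) (q : Polynomial ℤ) (h0 : q.coeff 0 = 1) :
    ((Pz N c).comp q).coeff 4 = pD N c * q.coeff 4 + pH N c * (2 * (q.coeff 1 * q.coeff 3) + q.coeff 2 ^ 2) +
      3 * pT N c * (q.coeff 1 ^ 2 * q.coeff 2) + pQ N c * q.coeff 1 ^ 4 := by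
  have hT : 3 * pT N c * (q.coeff 1 ^ 2 * q.coeff 2) =
      ∑ n ∈ Finset.range (2 * c + 2), 3 * (n.choose 3 : ℤ) * N c n * (q.coeff 1 ^ 2 * q.coeff 2) := by
    rw [pT, Finset.mul_sum, Finset.sum_mul]
    refine Finset.sum_congr rfl fun n _ => ?_
    ring
  rw [Pz_comp_eq, Polynomial.finsetSum_coeff, pD, pH, pQ, hT, Finset.sum_mul, Finset.sum_mul, Finset.sum_mul, ← Finset.sum_add_distrib,
    ← Finset.sum_add_distrib, ← Finset.sum_add_distrib]
  refine Finset.sum_congr rfl fun n _ => ?_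
  rw [Polynomial.coeff_C_mul, coeff_pow_four q h0 n]
  ring

/-- ★ `a_5 = −([X⁴](P₁∘A₄) + [X³](P₂∘A₄) + [X²](P₃∘A₄) + [X¹](P₄∘A₄) + pS₅)` in the moments.
[cite: JansevanRensburgWhittington2013, §3.2 Theorem 8 (arXiv v4 p. 11)] -/
theorem a_five : a N 5 = -((pD N 1 * a N 4 + pH N 1 * (2 * (a N 1 * a N 3) + a N 2 ^ 2) + 3 * pT N 1 * (a N 1 ^ 2 * a N 2) + pQ N 1 * a N 1 ^ 4)
    + (pD N 2 * a N 3 + 2 * pH N 2 * (a N 1 * a N 2) + pT N 2 * a N 1 ^ 3) + (pD N 3 * a N 2 + pH N 3 * a N 1 ^ 2)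
    + pD N 4 * a N 1 + pS N 5) := by
  have h0 : (A N 4).coeff 0 = 1 := coeff_A_zero_eq_one N 4
  rw [a_succ]
  simp only [Finset.sum_range_succ, Finset.sum_range_zero, Nat.reduceAdd, Nat.reduceSub, Nat.sub_self, zero_add]
  rw [coeff_Pz_comp_four N 1 _ h0, coeff_Pz_comp_three N 2 _ h0, coeff_Pz_comp_two N 3 _ h0, coeff_Pz_comp_one N 4 _ h0,
    coeff_Pz_comp_zero N 5 _ h0, coeff_A_eq_a N (show 4 ≤ 4 from le_rfl), coeff_A_eq_a N (show 3 ≤ 4 by norm_num),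
    coeff_A_eq_a N (show 2 ≤ 4 by norm_num), coeff_A_eq_a N (show 1 ≤ 4 by norm_num)]

/-- ★ `e_5 = −(a_1 e_4 + a_2 e_3 + a_3 e_2 + a_4 e_1 + a_5)`. [cite: JansevanRensburgWhittington2013, §3.2 Theorem 8 (arXiv v4 p. 11)] -/
theorem e_five_eq : e N 5 = -(a N 1 * e N 4 + a N 2 * e N 3 + a N 3 * e N 2 + a N 4 * e N 1 + a N 5) := by
  have h := sum_antidiagonal_a_mul_e N (k := 5) (by norm_num)
  rw [Finset.Nat.sum_antidiagonal_eq_sum_range_succ_mk] at h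
  simp only [Finset.sum_range_succ, Finset.sum_range_zero, Nat.reduceSub, Nat.sub_self, a_zero, e_zero, zero_add, one_mul,
    mul_one] at h
  linear_combination h

end CostSeries

/-! ### Five transverse unit steps never sum to zero -/

/-- Five transverse unit steps never sum to zero (parity of the coordinate sum). [cite: MadrasSlade1993, Definition 1.2.4] -/
theorem twoStepV_sum_five_ne_zero (d : ℕ) (a b c e f : Fin d × Bool) :
    twoStepV d a + twoStepV d b + twoStepV d c + twoStepV d e + twoStepV d f ≠ 0 := by
  rcases a with ⟨ja, ba⟩; rcases b with ⟨jb, bb⟩; rcases c with ⟨jc, bc⟩; rcases e with ⟨je, be⟩; rcases f with ⟨jf, bf⟩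
  intro h
  have hs := congrArg (fun x : Site (d + 1) => ∑ i, x i) h
  simp only [Pi.add_apply, Finset.sum_add_distrib, Pi.zero_apply, Finset.sum_const_zero, twoStepV, Finset.sum_pi_single',
    Finset.mem_univ, if_true] at hs
  cases ba <;> cases bb <;> cases bc <;> cases be <;> cases bf <;> simp at hs

/-! ### The index set of the five-step self-avoiding walks of the transverse lattice -/

/-- Decidable equality of five-tuples of transverse step indices (instance search does not reach five-fold products unaided).
[cite: MadrasSlade1993, §1.2] -/
instance instDecidableEqIdx5 (d : ℕ) :
    DecidableEq ((Fin d × Bool) × (Fin d × Bool) × (Fin d × Bool) × (Fin d × Bool) × (Fin d × Bool)) :=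
  instDecidableEqProd

/-- Five transverse steps with no immediate reversal. [cite: MadrasSlade1993, §1.2] -/
def nonrevFive (d : ℕ) : Finset ((Fin d × Bool) × (Fin d × Bool) × (Fin d × Bool) × (Fin d × Bool) × (Fin d × Bool)) :=
  Finset.univ.filter fun s => s.2.1 ≠ revIdx s.1 ∧ s.2.2.1 ≠ revIdx s.2.1 ∧ s.2.2.2.1 ≠ revIdx s.2.2.1 ∧ s.2.2.2.2 ≠ revIdx s.2.2.2.1

/-- No immediate reversal and a unit square on steps `1–4`: `(v, w, −v, −w, x)`. [cite: MadrasSlade1993, §1.2] -/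
def squareA (d : ℕ) : Finset ((Fin d × Bool) × (Fin d × Bool) × (Fin d × Bool) × (Fin d × Bool) × (Fin d × Bool)) :=
  (nonrevFive d).filter fun s => s.2.2.1 = revIdx s.1 ∧ s.2.2.2.1 = revIdx s.2.1

/-- No immediate reversal and a unit square on steps `2–5`: `(x, v, w, −v, −w)`. [cite: MadrasSlade1993, §1.2] -/
def squareB (d : ℕ) : Finset ((Fin d × Bool) × (Fin d × Bool) × (Fin d × Bool) × (Fin d × Bool) × (Fin d × Bool)) :=
  (nonrevFive d).filter fun s => s.2.2.2.1 = revIdx s.2.1 ∧ s.2.2.2.2 = revIdx s.2.2.1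

/-- The index set of the cost-five irreducible bridges of length six (five-step self-avoiding walks of `ℤ^d`).
[cite: MadrasSlade1993, §4.2, eq. (4.2.20)–(4.2.22) (p. 94, 2013 reprint)] -/
def sixStepIndex (d : ℕ) : Finset ((Fin d × Bool) × (Fin d × Bool) × (Fin d × Bool) × (Fin d × Bool) × (Fin d × Bool)) := nonrevFive d \ (squareA d ∪ squareB d)

/-- Membership in `sixStepIndex`. [cite: MadrasSlade1993, §1.2] -/
theorem mem_sixStepIndex {d : ℕ} {s : ((Fin d × Bool) × (Fin d × Bool) × (Fin d × Bool) × (Fin d × Bool) × (Fin d × Bool))} : s ∈ sixStepIndex d ↔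
    (s.2.1 ≠ revIdx s.1 ∧ s.2.2.1 ≠ revIdx s.2.1 ∧ s.2.2.2.1 ≠ revIdx s.2.2.1 ∧ s.2.2.2.2 ≠ revIdx s.2.2.2.1) ∧
      ¬ (s.2.2.1 = revIdx s.1 ∧ s.2.2.2.1 = revIdx s.2.1) ∧ ¬ (s.2.2.2.1 = revIdx s.2.1 ∧ s.2.2.2.2 = revIdx s.2.2.1) := by
  simp only [sixStepIndex, nonrevFive, squareA, squareB, Finset.mem_sdiff, Finset.mem_union, Finset.mem_filter, Finset.mem_univ,
    true_and, not_or]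
  tauto

/-- `#nonrevFive = 2d(2d−1)⁴`. [cite: MadrasSlade1993, §1.2] -/
theorem card_nonrevFive (d : ℕ) : (nonrevFive d).card = 2 * d * (2 * d - 1) ^ 4 := by
  classical
  have heq : nonrevFive d = (nonrevFour d).biUnion fun t =>
      (Finset.univ.filter fun f : Fin d × Bool => f ≠ revIdx t.2.2.2).image fun f => (t.1, t.2.1, t.2.2.1, t.2.2.2, f) := by
    ext ⟨a, b, c, e, f⟩
    simp only [nonrevFive, nonrevFour, Finset.mem_filter, Finset.mem_univ, true_and, Finset.mem_biUnion, Finset.mem_image, Prod.mk.injEq]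
    constructor
    · rintro ⟨h1, h2, h3, h4⟩
      exact ⟨(a, b, c, e), ⟨h1, h2, h3⟩, f, h4, rfl, rfl, rfl, rfl, rfl⟩
    · rintro ⟨t, ⟨h1, h2, h3⟩, f', h4, rfl, rfl, rfl, rfl, rfl⟩
      exact ⟨h1, h2, h3, h4⟩
  rw [heq, Finset.card_biUnion]
  · have : ∀ t ∈ nonrevFour d, ((Finset.univ.filter fun f : Fin d × Bool => f ≠ revIdx t.2.2.2).image
        fun f => (t.1, t.2.1, t.2.2.1, t.2.2.2, f)).card = 2 * d - 1 := by
      intro t _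
      rw [Finset.card_image_of_injective _ (fun f f' h => by simpa using h), card_filter_ne_idx]
    rw [Finset.sum_congr rfl this, Finset.sum_const, card_nonrevFour, smul_eq_mul]
    ring
  · intro t _ t' _ htt'
    simp only [Function.onFun]
    rw [Finset.disjoint_left]
    intro x hx hx'
    obtain ⟨f, -, rfl⟩ := Finset.mem_image.1 hx
    obtain ⟨f', -, h⟩ := Finset.mem_image.1 hx'
    simp only [Prod.mk.injEq] at h
    obtain ⟨h1, h2, h3, h4, -⟩ := h
    exact htt' (Prod.ext h1.symm (Prod.ext h2.symm (Prod.ext h3.symm h4.symm)))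

/-- `#squareA = 2d(2d−2)(2d−1)` (a square `(v, w, −v, −w)`, `w ≠ ±v`, then `x ≠ w`). [cite: MadrasSlade1993, §1.2] -/
theorem card_squareA (d : ℕ) : (squareA d).card = 2 * d * (2 * d - 2) * (2 * d - 1) := by
  classical
  have heq : squareA d = (squareFour d).biUnion fun t =>
      (Finset.univ.filter fun f : Fin d × Bool => f ≠ revIdx t.2.2.2).image fun f => (t.1, t.2.1, t.2.2.1, t.2.2.2, f) := by
    ext ⟨a, b, c, e, f⟩
    simp only [squareA, nonrevFive, squareFour, Finset.mem_filter, Finset.mem_univ, true_and, Finset.mem_biUnion, Finset.mem_image,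
      Prod.mk.injEq]
    constructor
    · rintro ⟨⟨h1, h2, h3, h4⟩, h5, h6⟩
      refine ⟨(a, b, c, e), ⟨h1, show b ≠ a from fun hba => h2 (by rw [h5, hba]), h5, h6⟩, f, h4, rfl, rfl, rfl, rfl, rfl⟩
    · rintro ⟨t, ⟨h1, h2, h3, h4⟩, f', h5, rfl, rfl, rfl, rfl, rfl⟩
      refine ⟨⟨h1, ?_, ?_, h5⟩, h3, h4⟩
      · rw [h3]; exact fun h => h2 (revIdx_inj h).symm
      · rw [h4, h3, revIdx_revIdx]; exact fun h => h1 (by rw [← h, revIdx_revIdx])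
  rw [heq, Finset.card_biUnion]
  · have : ∀ t ∈ squareFour d, ((Finset.univ.filter fun f : Fin d × Bool => f ≠ revIdx t.2.2.2).image
        fun f => (t.1, t.2.1, t.2.2.1, t.2.2.2, f)).card = 2 * d - 1 := by
      intro t _
      rw [Finset.card_image_of_injective _ (fun f f' h => by simpa using h), card_filter_ne_idx]
    rw [Finset.sum_congr rfl this, Finset.sum_const, card_squareFour, smul_eq_mul]
  · intro t _ t' _ htt'
    simp only [Function.onFun]
    rw [Finset.disjoint_left]
    intro x hx hx'
    obtain ⟨f, -, rfl⟩ := Finset.mem_image.1 hx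
    obtain ⟨f', -, h⟩ := Finset.mem_image.1 hx'
    simp only [Prod.mk.injEq] at h
    obtain ⟨h1, h2, h3, h4, -⟩ := h
    exact htt' (Prod.ext h1.symm (Prod.ext h2.symm (Prod.ext h3.symm h4.symm)))

/-- `#squareB = 2d(2d−1)(2d−2)` (`(x, v, w, −v, −w)` with `v ≠ −x`, `w ≠ ±v`). [cite: MadrasSlade1993, §1.2] -/
theorem card_squareB (d : ℕ) : (squareB d).card = 2 * d * (2 * d - 1) * (2 * d - 2) := by
  classical
  have hA : Fintype.card (Fin d × Bool) = 2 * d := by rw [Fintype.card_prod, Fintype.card_fin, Fintype.card_bool, mul_comm]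
  -- parametrise by `(x, v, w)` with `v ≠ −x`, `w ≠ v`, `w ≠ −v`
  set P : Finset ((Fin d × Bool) × (Fin d × Bool) × (Fin d × Bool)) :=
    Finset.univ.filter fun t => t.2.1 ≠ revIdx t.1 ∧ t.2.2 ≠ revIdx t.2.1 ∧ t.2.2 ≠ t.2.1 with hP
  have heq : squareB d = P.image fun t => (t.1, t.2.1, t.2.2, revIdx t.2.1, revIdx t.2.2) := by
    ext ⟨a, b, c, e, f⟩
    simp only [squareB, nonrevFive, hP, Finset.mem_filter, Finset.mem_univ, true_and, Finset.mem_image, Prod.mk.injEq]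
    constructor
    · rintro ⟨⟨h1, h2, h3, h4⟩, h5, h6⟩
      refine ⟨(a, b, c), ⟨h1, h2, show c ≠ b from fun hcb => h3 (by rw [h5, hcb])⟩, rfl, rfl, rfl, h5.symm, h6.symm⟩
    · rintro ⟨t, ⟨h1, h2, h3⟩, rfl, rfl, rfl, h5, h6⟩
      refine ⟨⟨h1, h2, ?_, ?_⟩, h5.symm, h6.symm⟩
      · rw [← h5]; exact fun h => h3 (revIdx_inj h).symm
      · rw [← h6, ← h5, revIdx_revIdx]; exact fun h => h2 (by rw [← h, revIdx_revIdx])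
  have hPcard : P.card = 2 * d * (2 * d - 1) * (2 * d - 2) := by
    have heqP : P = (threeStepIndex d).biUnion fun u =>
        (Finset.univ.filter fun w : Fin d × Bool => w ≠ revIdx u.2 ∧ w ≠ u.2).image fun w => (u.1, u.2, w) := by
      ext ⟨x, v, w⟩
      simp only [hP, threeStepIndex, Finset.mem_filter, Finset.mem_univ, true_and, Finset.mem_biUnion, Finset.mem_image, Prod.mk.injEq]
      constructor
      · rintro ⟨h1, h2, h3⟩
        exact ⟨(x, v), h1, w, ⟨h2, h3⟩, rfl, rfl, rfl⟩
      · rintro ⟨u, h1, w', ⟨h2, h3⟩, rfl, rfl, rfl⟩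
        exact ⟨h1, h2, h3⟩
    rw [heqP, Finset.card_biUnion]
    · have : ∀ u ∈ threeStepIndex d, ((Finset.univ.filter fun w : Fin d × Bool => w ≠ revIdx u.2 ∧ w ≠ u.2).image
          fun w => (u.1, u.2, w)).card = 2 * d - 2 := by
        intro u _
        rw [Finset.card_image_of_injective _ (fun w w' h => by simpa using h), card_filter_ne_ne_idx d (revIdx_ne_self u.2)]
      rw [Finset.sum_congr rfl this, Finset.sum_const, card_threeStepIndex, smul_eq_mul]
    · intro u _ u' _ huu'
      simp only [Function.onFun]
      rw [Finset.disjoint_left]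
      intro x hx hx'
      obtain ⟨w, -, rfl⟩ := Finset.mem_image.1 hx
      obtain ⟨w', -, h⟩ := Finset.mem_image.1 hx'
      simp only [Prod.mk.injEq] at h
      exact huu' (Prod.ext h.1.symm h.2.1.symm)
  rw [heq, Finset.card_image_of_injective, hPcard]
  intro t t' h
  simp only [Prod.mk.injEq] at h
  exact Prod.ext h.1 (Prod.ext h.2.1 h.2.2.1)

/-- `#(squareA ∩ squareB) = 2d(2d−2)` (`(v, w, −v, −w, v)`). [cite: MadrasSlade1993, §1.2] -/
theorem card_squareA_inter_squareB (d : ℕ) : (squareA d ∩ squareB d).card = 2 * d * (2 * d - 2) := by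
  classical
  have heq : squareA d ∩ squareB d = (squareFour d).image fun t => (t.1, t.2.1, t.2.2.1, t.2.2.2, t.1) := by
    ext ⟨a, b, c, e, f⟩
    simp only [squareA, squareB, nonrevFive, squareFour, Finset.mem_inter, Finset.mem_filter, Finset.mem_univ, true_and,
      Finset.mem_image, Prod.mk.injEq]
    constructor
    · rintro ⟨⟨⟨h1, h2, h3, h4⟩, h5, h6⟩, -, -, h8⟩
      refine ⟨(a, b, c, e), ⟨h1, show b ≠ a from fun hba => h2 (by rw [h5, hba]), h5, h6⟩, rfl, rfl, rfl, rfl, ?_⟩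
      rw [h8, h5, revIdx_revIdx]
    · rintro ⟨t, ⟨h1, h2, h3, h4⟩, rfl, rfl, rfl, rfl, rfl⟩
      have n2 : t.2.2.1 ≠ revIdx t.2.1 := by rw [h3]; exact fun h => h2 (revIdx_inj h).symm
      have n3 : t.2.2.2 ≠ revIdx t.2.2.1 := by rw [h4, h3, revIdx_revIdx]; exact fun h => h1 (by rw [← h, revIdx_revIdx])
      have n4 : t.1 ≠ revIdx t.2.2.2 := by rw [h4, revIdx_revIdx]; exact fun h => h2 h.symm
      exact ⟨⟨⟨h1, n2, n3, n4⟩, h3, h4⟩, ⟨h1, n2, n3, n4⟩, h4, by rw [h3, revIdx_revIdx]⟩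
  rw [heq, Finset.card_image_of_injective, card_squareFour]
  intro t t' h
  simp only [Prod.mk.injEq] at h
  exact Prod.ext h.1 (Prod.ext h.2.1 (Prod.ext h.2.2.1 h.2.2.2.1))

/-- ★ `#sixStepIndex + 2d(2d−2)(4d−3) = 2d(2d−1)⁴` (inclusion–exclusion, subtraction-free). [cite: MadrasSlade1993, §1.2] -/
theorem card_sixStepIndex_add (d : ℕ) : (sixStepIndex d).card + 2 * d * (2 * d - 2) * (4 * d - 3) = 2 * d * (2 * d - 1) ^ 4 := by
  classical
  have hsub : squareA d ∪ squareB d ⊆ nonrevFive d :=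
    Finset.union_subset (Finset.filter_subset _ _) (Finset.filter_subset _ _)
  have h1 := Finset.card_sdiff_add_card_eq_card hsub
  have h2 := Finset.card_union_add_card_inter (squareA d) (squareB d)
  rw [card_squareA, card_squareB, card_squareA_inter_squareB] at h2
  rw [card_nonrevFive] at h1
  rw [sixStepIndex]
  rcases Nat.eq_zero_or_pos d with rfl | hd
  · simp only [mul_zero, zero_mul, add_zero] at h1 ⊢
    omega
  · obtain ⟨e, rfl⟩ : ∃ e, d = e + 1 := ⟨d - 1, by omega⟩
    simp only [show 2 * (e + 1) - 2 = 2 * e by omega, show 2 * (e + 1) - 1 = 2 * e + 1 by omega,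
      show 4 * (e + 1) - 3 = 4 * e + 1 by omega] at h1 h2 ⊢
    zify at h1 h2 ⊢
    linear_combination h1 - h2

/-! ### The cost-five irreducible bridges of length six -/

/-- The six-step walk `(0, e₀, e₀+v₁, …, e₀+v₁+⋯+v₅)`. [cite: MadrasSlade1993, Definition 1.2.4] -/
def sixStep (d : ℕ) (s : (Fin d × Bool) × (Fin d × Bool) × (Fin d × Bool) × (Fin d × Bool) × (Fin d × Bool)) : ℕ → Site (d + 1) :=
  fun i =>
  if i = 0 then 0 else if i = 1 then Pi.single 0 1 else if i = 2 then Pi.single 0 1 + twoStepV d s.1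
  else if i = 3 then Pi.single 0 1 + twoStepV d s.1 + twoStepV d s.2.1
  else if i = 4 then Pi.single 0 1 + twoStepV d s.1 + twoStepV d s.2.1 + twoStepV d s.2.2.1
  else if i = 5 then Pi.single 0 1 + twoStepV d s.1 + twoStepV d s.2.1 + twoStepV d s.2.2.1 + twoStepV d s.2.2.2.1
  else Pi.single 0 1 + twoStepV d s.1 + twoStepV d s.2.1 + twoStepV d s.2.2.1 + twoStepV d s.2.2.2.1 + twoStepV d s.2.2.2.2

/-- Value at `0`. [cite: MadrasSlade1993, Definition 1.2.4] -/
@[simp] theorem sixStep_zero (d : ℕ) (s) : sixStep d s 0 = 0 := by simp [sixStep]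

/-- Value at `1`. [cite: MadrasSlade1993, Definition 1.2.4] -/
@[simp] theorem sixStep_one (d : ℕ) (s) : sixStep d s 1 = Pi.single 0 1 := by simp [sixStep]

/-- Value at `2`. [cite: MadrasSlade1993, Definition 1.2.4] -/
@[simp] theorem sixStep_two (d : ℕ) (s) : sixStep d s 2 = Pi.single 0 1 + twoStepV d s.1 := by simp [sixStep]

/-- Value at `3`. [cite: MadrasSlade1993, Definition 1.2.4] -/
@[simp] theorem sixStep_three (d : ℕ) (s) : sixStep d s 3 = Pi.single 0 1 + twoStepV d s.1 + twoStepV d s.2.1 := by simp [sixStep]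

/-- Value at `4`. [cite: MadrasSlade1993, Definition 1.2.4] -/
@[simp] theorem sixStep_four (d : ℕ) (s) :
    sixStep d s 4 = Pi.single 0 1 + twoStepV d s.1 + twoStepV d s.2.1 + twoStepV d s.2.2.1 := by simp [sixStep]

/-- Value at `5`. [cite: MadrasSlade1993, Definition 1.2.4] -/
@[simp] theorem sixStep_five (d : ℕ) (s) :
    sixStep d s 5 = Pi.single 0 1 + twoStepV d s.1 + twoStepV d s.2.1 + twoStepV d s.2.2.1 + twoStepV d s.2.2.2.1 := by
  simp [sixStep]

/-- Value at `i ≥ 6`. [cite: MadrasSlade1993, Definition 1.2.4] -/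
theorem sixStep_of_six_le (d : ℕ) (s) {i : ℕ} (hi : 6 ≤ i) : sixStep d s i =
    Pi.single 0 1 + twoStepV d s.1 + twoStepV d s.2.1 + twoStepV d s.2.2.1 + twoStepV d s.2.2.2.1 + twoStepV d s.2.2.2.2 := by
  have h0 : i ≠ 0 := by omega
  have h1 : i ≠ 1 := by omega
  have h2 : i ≠ 2 := by omega
  have h3 : i ≠ 3 := by omega
  have h4 : i ≠ 4 := by omega
  have h5 : i ≠ 5 := by omega
  simp [sixStep, h0, h1, h2, h3, h4, h5]

/-- Heights along `sixStep`: `0, 1, 1, …`. [cite: MadrasSlade1993, Definition 1.2.4] -/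
theorem sixStep_apply_zero (d : ℕ) (s) (i : ℕ) : sixStep d s i 0 = if i = 0 then 0 else 1 := by
  rcases Nat.lt_or_ge i 6 with hi | hi
  · interval_cases i <;> simp
  · rw [sixStep_of_six_le d s hi, if_neg (by omega)]
    simp

/-- `sixStep s`, `s ∈ sixStepIndex`, is a six-step self-avoiding walk (fifteen pairs of equal-height sites: single steps, non-reversing
pairs, odd triples and quintuples by parity, and the two quadruples by the square lemma). [cite: MadrasSlade1993, Definition 1.2.4] -/
theorem sixStep_mem_saws (d : ℕ) {s} (hs : s ∈ sixStepIndex d) : sixStep d s ∈ saws (d + 1) 6 := by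
  obtain ⟨⟨h12, h23, h34, h45⟩, hsqA, hsqB⟩ := mem_sixStepIndex.1 hs
  refine mem_saws.2 ⟨sixStep_zero d s, fun i hi => ?_, fun i hi => ?_, ?_⟩
  · rw [sixStep_of_six_le d s hi, sixStep_of_six_le d s le_rfl]
  · interval_cases i
    · rw [sixStep_zero, sixStep_one, zdGraph_adj_iff]
      exact ⟨0, Or.inl (by simp)⟩
    · rw [sixStep_one, sixStep_two]; exact adj_add_twoStepV d _ _
    · rw [sixStep_two, sixStep_three]; exact adj_add_twoStepV d _ _
    · rw [sixStep_three, sixStep_four]; exact adj_add_twoStepV d _ _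
    · rw [sixStep_four, sixStep_five]; exact adj_add_twoStepV d _ _
    · rw [sixStep_five, sixStep_of_six_le d s le_rfl]; exact adj_add_twoStepV d _ _
  · have hne : ∀ i j : ℕ, i ≤ 6 → j ≤ 6 → i < j → sixStep d s i ≠ sixStep d s j := by
      intro i j hi hj hij h
      have hh := congrFun h 0
      rw [sixStep_apply_zero, sixStep_apply_zero] at hh
      have hi0 : i ≠ 0 := by rintro rfl; simp [show j ≠ 0 by omega] at hh
      have key : (i = 1 ∧ j = 2) ∨ (i = 2 ∧ j = 3) ∨ (i = 3 ∧ j = 4) ∨ (i = 4 ∧ j = 5) ∨ (i = 5 ∧ j = 6) ∨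
          (i = 1 ∧ j = 3) ∨ (i = 2 ∧ j = 4) ∨ (i = 3 ∧ j = 5) ∨ (i = 4 ∧ j = 6) ∨
          (i = 1 ∧ j = 4) ∨ (i = 2 ∧ j = 5) ∨ (i = 3 ∧ j = 6) ∨
          (i = 1 ∧ j = 5) ∨ (i = 2 ∧ j = 6) ∨ (i = 1 ∧ j = 6) := by
        have hi1 : 1 ≤ i := Nat.pos_of_ne_zero hi0
        interval_cases i <;> interval_cases j <;> simp
      rcases key with ⟨rfl, rfl⟩ | ⟨rfl, rfl⟩ | ⟨rfl, rfl⟩ | ⟨rfl, rfl⟩ | ⟨rfl, rfl⟩ | ⟨rfl, rfl⟩ | ⟨rfl, rfl⟩ | ⟨rfl, rfl⟩ |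
          ⟨rfl, rfl⟩ | ⟨rfl, rfl⟩ | ⟨rfl, rfl⟩ | ⟨rfl, rfl⟩ | ⟨rfl, rfl⟩ | ⟨rfl, rfl⟩ | ⟨rfl, rfl⟩
      -- gap 1: single steps
      · rw [sixStep_one, sixStep_two] at h
        exact twoStepV_ne_zero d s.1 (by simpa using h.symm)
      · rw [sixStep_two, sixStep_three] at h
        exact twoStepV_ne_zero d s.2.1 (by simpa using h.symm)
      · rw [sixStep_three, sixStep_four] at h
        exact twoStepV_ne_zero d s.2.2.1 (by simpa using h.symm)
      · rw [sixStep_four, sixStep_five] at h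
        exact twoStepV_ne_zero d s.2.2.2.1 (by simpa using h.symm)
      · rw [sixStep_five, sixStep_of_six_le d s le_rfl] at h
        exact twoStepV_ne_zero d s.2.2.2.2 (by simpa using h.symm)
      -- gap 2: no immediate reversal
      · rw [sixStep_one, sixStep_three, add_assoc] at h
        exact twoStepV_add_ne_zero d h12 (by simpa using h.symm)
      · rw [sixStep_two, sixStep_four, add_assoc (Pi.single 0 1 + twoStepV d s.1)] at h
        exact twoStepV_add_ne_zero d h23 (by simpa using h.symm)
      · rw [sixStep_three, sixStep_five, add_assoc (Pi.single 0 1 + twoStepV d s.1 + twoStepV d s.2.1)] at h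
        exact twoStepV_add_ne_zero d h34 (by simpa using h.symm)
      · rw [sixStep_four, sixStep_of_six_le d s le_rfl, add_assoc (Pi.single 0 1 + twoStepV d s.1 + twoStepV d s.2.1 + twoStepV d s.2.2.1)] at h
        exact twoStepV_add_ne_zero d h45 (by simpa using h.symm)
      -- gap 3: parity
      · rw [sixStep_one, sixStep_four, add_assoc, add_assoc] at h
        have h' : twoStepV d s.1 + (twoStepV d s.2.1 + twoStepV d s.2.2.1) = 0 := by simpa using h.symm
        exact twoStepV_add_add_ne_zero d _ _ _ (by rw [add_assoc]; exact h')
      · rw [sixStep_two, sixStep_five, add_assoc (Pi.single 0 1 + twoStepV d s.1), add_assoc (Pi.single 0 1 + twoStepV d s.1)] at h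
        have h' : twoStepV d s.2.1 + twoStepV d s.2.2.1 + twoStepV d s.2.2.2.1 = 0 := by simpa using h.symm
        exact twoStepV_add_add_ne_zero d _ _ _ h'
      · rw [sixStep_three, sixStep_of_six_le d s le_rfl, add_assoc (Pi.single 0 1 + twoStepV d s.1 + twoStepV d s.2.1), add_assoc (Pi.single 0 1 + twoStepV d s.1 + twoStepV d s.2.1)] at h
        have h' : twoStepV d s.2.2.1 + twoStepV d s.2.2.2.1 + twoStepV d s.2.2.2.2 = 0 := by simpa using h.symm
        exact twoStepV_add_add_ne_zero d _ _ _ h'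
      -- gap 4: the square lemma
      · rw [sixStep_one, sixStep_five, add_assoc, add_assoc, add_assoc] at h
        have h' : twoStepV d s.1 + (twoStepV d s.2.1 + (twoStepV d s.2.2.1 + twoStepV d s.2.2.2.1)) = 0 := by simpa using h.symm
        exact hsqA (eq_revIdx_of_sum_four_eq_zero d h12 h23 (by rw [add_assoc, add_assoc]; exact h'))
      · rw [sixStep_two, sixStep_of_six_le d s le_rfl, add_assoc (Pi.single 0 1 + twoStepV d s.1), add_assoc (Pi.single 0 1 + twoStepV d s.1), add_assoc (Pi.single 0 1 + twoStepV d s.1)] at h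
        have h' : twoStepV d s.2.1 + twoStepV d s.2.2.1 + twoStepV d s.2.2.2.1 + twoStepV d s.2.2.2.2 = 0 := by simpa using h.symm
        exact hsqB (eq_revIdx_of_sum_four_eq_zero d h23 h34 h')
      -- gap 5: parity
      · rw [sixStep_one, sixStep_of_six_le d s le_rfl, add_assoc, add_assoc, add_assoc, add_assoc] at h
        have h' : twoStepV d s.1 + (twoStepV d s.2.1 + (twoStepV d s.2.2.1 + (twoStepV d s.2.2.2.1 + twoStepV d s.2.2.2.2))) = 0 := by
          simpa using h.symm
        exact twoStepV_sum_five_ne_zero d _ _ _ _ _ (by rw [add_assoc, add_assoc, add_assoc]; exact h')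
    intro i hi j hj h
    simp only [Set.mem_setOf_eq] at hi hj
    rcases lt_trichotomy i j with hij | rfl | hij
    · exact absurd h (hne i j hi hj hij)
    · rfl
    · exact absurd h.symm (hne j i hj hi hij)

/-- `sixStep s` is an irreducible bridge of cost five. [cite: DuminilCopinHammond2013, §2.2] -/
theorem sixStep_mem_filter (d : ℕ) {s} (hs : s ∈ sixStepIndex d) :
    sixStep d s ∈ (irreducibleBridges (d + 1) 6).filter fun ω => costZd d 6 ω = 5 := by
  have hb : IsBridge 6 (sixStep d s) := by
    intro i h1 h2
    rw [sixStep_apply_zero, sixStep_apply_zero, sixStep_apply_zero, if_pos rfl, if_neg (by omega), if_neg (by omega)]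
    exact ⟨zero_lt_one, le_rfl⟩
  refine Finset.mem_filter.2 ⟨mem_irreducibleBridges.2 ⟨mem_bridges.2 ⟨sixStep_mem_saws d hs, hb⟩,
    ⟨by norm_num, hb, fun k hk1 hk2 hren => ?_⟩⟩, ?_⟩
  · have h := (hren.2.2 1 le_rfl (by omega)).1
    simp only [add_zero, sixStep_apply_zero] at h
    have hk0 : k ≠ 0 := by omega
    have hk1' : k + 1 ≠ 0 := by omega
    rw [if_neg hk0, if_neg hk1'] at h
    exact lt_irrefl _ h
  · simp [costZd, sixStep_apply_zero]

/-- ★ **Every cost-five irreducible bridge of length six is a `sixStep`** (span one; self-avoidance gives the index conditions).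
[cite: MadrasSlade1993, Definition 1.2.4] -/
theorem eq_sixStep_of_mem (d : ℕ) {ω : ℕ → Site (d + 1)}
    (hω : ω ∈ (irreducibleBridges (d + 1) 6).filter fun ω => costZd d 6 ω = 5) : ∃ s ∈ sixStepIndex d, ω = sixStep d s := by
  obtain ⟨hirr, hcost⟩ := Finset.mem_filter.1 hω
  obtain ⟨hbr, -⟩ := mem_irreducibleBridges.1 hirr
  obtain ⟨hωs, hb⟩ := mem_bridges.1 hbr
  obtain ⟨h0, hend, hadj, hinj⟩ := mem_saws.1 hωs
  have hω1 : ω 1 = Pi.single 0 1 := apply_one_eq_e0_of_mem_bridges d (by norm_num) hbr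
  have h6eq : ω 6 0 = 1 := by
    have hc : costZd d 6 ω = 5 := hcost
    simp only [costZd] at hc
    have := (span_le_and_cost_bound_zd hirr).1
    have h60 : 0 < ω 6 0 := by have := (hb 6 (by norm_num) le_rfl).1; rwa [h0] at this
    omega
  have h1eq : ω 1 0 = 1 := by rw [hω1]; simp
  have hieq : ∀ i, 1 ≤ i → i ≤ 6 → ω i 0 = 1 := by
    intro i hi1 hi6
    have h := hb i hi1 hi6
    rw [h0, h6eq] at h
    simp only [Pi.zero_apply] at h
    omega
  obtain ⟨a, ha⟩ := exists_twoStepV_of_adj d (hadj 1 (by norm_num)) (by rw [hieq 2 (by norm_num) (by norm_num), h1eq])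
  obtain ⟨b, hb'⟩ := exists_twoStepV_of_adj d (hadj 2 (by norm_num))
    (by rw [hieq 3 (by norm_num) (by norm_num), hieq 2 (by norm_num) (by norm_num)])
  obtain ⟨c, hc'⟩ := exists_twoStepV_of_adj d (hadj 3 (by norm_num))
    (by rw [hieq 4 (by norm_num) (by norm_num), hieq 3 (by norm_num) (by norm_num)])
  obtain ⟨e, he'⟩ := exists_twoStepV_of_adj d (hadj 4 (by norm_num))
    (by rw [hieq 5 (by norm_num) (by norm_num), hieq 4 (by norm_num) (by norm_num)])
  obtain ⟨f, hf'⟩ := exists_twoStepV_of_adj d (hadj 5 (by norm_num))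
    (by rw [hieq 6 (by norm_num) le_rfl, hieq 5 (by norm_num) (by norm_num)])
  have hmem : ∀ i : ℕ, i ≤ 6 → i ∈ {j : ℕ | j ≤ 6} := fun i hi => hi
  have hab : b ≠ revIdx a := by
    intro hba
    have h13 : ω 3 = ω 1 := by rw [hb', ha, hba, revIdx, twoStepV_not, add_assoc, add_neg_cancel, add_zero]
    have := hinj (hmem 3 (by norm_num)) (hmem 1 (by norm_num)) h13
    omega
  have hbc : c ≠ revIdx b := by
    intro hcb
    have h24 : ω 4 = ω 2 := by rw [hc', hb', hcb, revIdx, twoStepV_not, add_assoc, add_neg_cancel, add_zero]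
    have := hinj (hmem 4 (by norm_num)) (hmem 2 (by norm_num)) h24
    omega
  have hce : e ≠ revIdx c := by
    intro hec
    have h35 : ω 5 = ω 3 := by rw [he', hc', hec, revIdx, twoStepV_not, add_assoc, add_neg_cancel, add_zero]
    have := hinj (hmem 5 (by norm_num)) (hmem 3 (by norm_num)) h35
    omega
  have hef : f ≠ revIdx e := by
    intro hfe
    have h46 : ω 6 = ω 4 := by rw [hf', he', hfe, revIdx, twoStepV_not, add_assoc, add_neg_cancel, add_zero]
    have := hinj (hmem 6 le_rfl) (hmem 4 (by norm_num)) h46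
    omega
  have hsqA : ¬ (c = revIdx a ∧ e = revIdx b) := by
    rintro ⟨hca, heb⟩
    have h15 : ω 5 = ω 1 := by
      rw [he', hc', hb', ha, hca, heb, revIdx, revIdx, twoStepV_not, twoStepV_not]
      abel
    have := hinj (hmem 5 (by norm_num)) (hmem 1 (by norm_num)) h15
    omega
  have hsqB : ¬ (e = revIdx b ∧ f = revIdx c) := by
    rintro ⟨heb, hfc⟩
    have h26 : ω 6 = ω 2 := by
      rw [hf', he', hc', hb', heb, hfc, revIdx, revIdx, twoStepV_not, twoStepV_not]
      abel
    have := hinj (hmem 6 le_rfl) (hmem 2 (by norm_num)) h26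
    omega
  refine ⟨(a, b, c, e, f), mem_sixStepIndex.2 ⟨⟨hab, hbc, hce, hef⟩, hsqA, hsqB⟩, funext fun i => ?_⟩
  rcases Nat.lt_or_ge i 6 with hi6 | hi6
  · interval_cases i
    · rw [h0, sixStep_zero]
    · rw [hω1, sixStep_one]
    · rw [ha, hω1, sixStep_two]
    · rw [hb', ha, hω1, sixStep_three]
    · rw [hc', hb', ha, hω1, sixStep_four]
    · rw [he', hc', hb', ha, hω1, sixStep_five]
  · rw [hend i hi6, hf', he', hc', hb', ha, hω1, sixStep_of_six_le d _ hi6]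

/-- `sixStep` is injective. [cite: MadrasSlade1993, Definition 1.2.4] -/
theorem sixStep_injective (d : ℕ) : Function.Injective (sixStep d) := by
  rintro ⟨a, b, c, e, f⟩ ⟨a', b', c', e', f'⟩ h
  have h2 := congrFun h 2
  rw [sixStep_two, sixStep_two, add_right_inj] at h2
  have ha : a = a' := twoStepV_injective d h2
  have h3 := congrFun h 3
  rw [sixStep_three, sixStep_three, ha, add_right_inj] at h3
  have hb : b = b' := twoStepV_injective d h3
  have h4 := congrFun h 4
  rw [sixStep_four, sixStep_four, ha, hb, add_right_inj] at h4
  have hc : c = c' := twoStepV_injective d h4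
  have h5 := congrFun h 5
  rw [sixStep_five, sixStep_five, ha, hb, hc, add_right_inj] at h5
  have he : e = e' := twoStepV_injective d h5
  have h6 := congrFun h 6
  rw [sixStep_of_six_le d _ le_rfl, sixStep_of_six_le d _ le_rfl, ha, hb, hc, he, add_right_inj] at h6
  have hf : f = f' := twoStepV_injective d h6
  rw [ha, hb, hc, he, hf]

/-- ★ The cost-five irreducible bridges of length six are exactly the `sixStep`s. [cite: MadrasSlade1993, §4.2, eq. (4.2.20)–(4.2.22) (p. 94, 2013 reprint)] -/
theorem filter_costZd_five_six_eq_image (d : ℕ) [DecidableEq (ℕ → Site (d + 1))] :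
    ((irreducibleBridges (d + 1) 6).filter fun ω => costZd d 6 ω = 5) = (sixStepIndex d).image (sixStep d) := by
  ext ω
  constructor
  · intro h
    obtain ⟨s, hs, rfl⟩ := eq_sixStep_of_mem d h
    exact Finset.mem_image_of_mem _ hs
  · intro h
    obtain ⟨s, hs, rfl⟩ := Finset.mem_image.1 h
    exact sixStep_mem_filter d hs

/-- ★ **`N_{5,6} + 2d(2d−2)(4d−3) = 2d(2d−1)⁴`** on `ℤ^{d+1}` (subtraction-free). [cite: MadrasSlade1993, §4.2, eq. (4.2.20)–(4.2.22) (p. 94, 2013 reprint)] -/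
theorem costCoeffZd_five_six_add (d : ℕ) : costCoeffZd d 5 6 + 2 * d * (2 * d - 2) * (4 * d - 3) = 2 * d * (2 * d - 1) ^ 4 := by
  classical
  rw [costCoeffZd, filter_costZd_five_six_eq_image, Finset.card_image_of_injective _ (sixStep_injective d)]
  exact card_sixStepIndex_add d

/-- ★ **`N_{5,6} = 2d(2d−1)⁴ − 2d(2d−2)(4d−3)`**, the number of five-step self-avoiding walks of `ℤ^d`.
[cite: MadrasSlade1993, §4.2, eq. (4.2.20)–(4.2.22) (p. 94, 2013 reprint)] -/
theorem costCoeffZd_five_six (d : ℕ) : costCoeffZd d 5 6 = 2 * d * (2 * d - 1) ^ 4 - 2 * d * (2 * d - 2) * (4 * d - 3) := by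
  have h := costCoeffZd_five_six_add d
  omega

end Literature.Probability.RandomPlanarGeometry.SAW.Zd

end
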